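import Summits.CriticalPhenomena.Ising3DConformalLimit.Theses.CanonicalBranchRefutation
import Summits.CriticalPhenomena.Ising3DConformalLimit.Theorems.CanonicalBranchRefutationInfraredExponentZeroSphereMassDeaveraging
import Literature.Probability.LatticeModels.CriticalTwoPointBounds
import Literature.Probability.LatticeModels.CorrelationDecayProofs

/-!
# Skeleton for the crux `InfraredExponentZero` of route `CanonicalBranchRefutation` (line `registered` =
# the BC3 birth skeleton, reshaped by the line lead 2026-08-17: stub signatures unfolded into tree vocabulary)

STATUS (lead c2, 2026-08-17): `stub_sphereMass_deaveraging` LANDED (p145289,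
`Theorems/CanonicalBranchRefutationInfraredExponentZeroSphereMassDeaveraging.lean`, imported below and used to
discharge that stub — 1 `sorry` left); `stub_sphereMass_growth` is PROVED EQUIVALENT to the crux
(`Theorems/CanonicalBranchRefutationInfraredExponentZeroSphereMass.lean`:
`infraredExponentZero_iff_sphereMass_growth`) — it is the open problem `η(3) ≤ 0` in shell-averaged form,
expected FALSE; rigorously only `c ≤ M(n) ≤ C n` (`sphereMass_window`).

Crux (item stmt-CriticalPhenomena-15521, rank 3, THE BRANCH HYPOTHESIS of the negation lens,
expected FALSE — η(3) ≈ 0.0363):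
`InfraredExponentZero := HasIsingExponentEta 3 0`, i.e. `log ⟨σ₀σ_x⟩⁺_{β_c(3)} / log ‖x‖ → -1`
along `cofinite` on `ℤ³`.

## The line: "sphere-mass growth + Messager–Miracle-Solé de-averaging + infrared ceiling"

What is KNOWN and in tree (used here as theorems, not stubs):
* the infrared ceiling and the Simon–Lieb floor `c‖x‖⁻² ≤ ⟨σ₀σ_x⟩_{β_c} ≤ C‖x‖⁻¹` on `ℤ³`
  (`criticalTwoPoint_bounds_holds`, Duminil-Copin 2019 Thm. 4.8; FSS76 + ADS15 + Simon80/Lieb80);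
* `‖x‖ → ∞` along `cofinite` (`Site.tendsto_norm_cofinite_atTop`).
So the upper half `limsup log G / log ‖x‖ ≤ -1` of the crux is a theorem; the whole open content is
the lower envelope `⟨σ₀σ_x⟩_{β_c} ≥ ‖x‖^{-1-o(1)}` ("no anomalous screening"). The line cuts that
lower envelope into an AVERAGED bet and a DE-AVERAGING inequality:

* `stub_sphereMass_growth` (THE BET, averaged form of η(3) ≤ 0): the critical sphere masses
  `M(n) := ∑_{‖y‖_∞ = n} ⟨σ₀σ_y⟩_{β_c}` grow like `n^{1-o(1)}` (`M(n) ~ n^{1-η}`; known rigorously: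
  `M(n) ≥ 1/(8dβ_c)` by Simon–Lieb at criticality, `M(n) ≤ C n` by the infrared bound; believed
  FALSE at exponent 1 since η ≈ 0.036). This is the susceptibility-type (sum-rule) form in which
  random-current / switching-lemma technology addresses η, and the form a refuter kills
  (`M(n_k) ≤ n_k^{1-δ}` along a sequence refutes it).
* `stub_sphereMass_deaveraging` (Messager–Miracle-Solé de-averaging, provable from the tree's
  `twoPointPlus_le_axis_of_mem_sphere` / `twoPointPlus_diagAxis_le_of_mem_sphere` with
  `messager_miracleSole(_diag)_holds`, `twoPointPlus_reflection/perm_invariant_holds` and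
  `card_sphere_succ_le`; Duminil-Copin 2019 §4.3 Exercise 37 (4), eq. (4.10)): for `x ≠ 0` with
  `‖x‖_∞ = m`, `⟨σ₀σ_x⟩ ≥ ⟨σ₀σ_{3m e₁}⟩ ≥ ⟨σ₀σ_y⟩` for every `y ∈ ∂Λ_{3m}`, hence
  `⟨σ₀σ_x⟩ ≥ M(3m)/#∂Λ_{3m} ≥ c m⁻² M(3m)`.

Assembly `InfraredExponentZero_of : stub 1 → stub 2 → InfraredExponentZero` (the two stub statements are
passed through the name-keyed aliases `__Registered.stub_*` so that the skeleton audit sees the hypotheses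
as the declared stubs BY NAME; real proof, no sorry; ≈ 70 lines):
the two stubs give the lower envelope
`c_ε ‖x‖^{-(1+ε)} ≤ ⟨σ₀σ_x⟩_{β_c}` eventually, for every `ε > 0`; the tree's infrared ceiling gives
`⟨σ₀σ_x⟩_{β_c} ≤ C‖x‖⁻¹`; the squeeze `hasSpatialDecayExponent_one_of_envelopes` (proved below, an
ε-version of the tree's `IsPowerBounded.hasSpatialDecayExponent_holds`) yields
`log ⟨σ₀σ_x⟩ / log ‖x‖ → -1 = -(3 - 2 + 0)`.

Disproof used: none on file for this crux (`ledger crux ls stmt-CriticalPhenomena-15521`: no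
`Disproof.lean` at registration, 2026-08-17). Negatives index: no Ising3D entry bears on either stub.
Sources: DuminilCopin2019 (Thm. 4.8, Exercise 37), MessagerMiracleSoleJSP1977, Simon1980,
FrohlichSimonSpencer1976, DuminilCopinPanis2025LowerBounds (Thm. 1.5: η ≤ 1/2 if it exists),
DuminilCopinICM2022 §4.2.1, KosPolandSimmonsDuffinVichi2016 / Hasenbusch2010 (η ≈ 0.0363: why the
bet is expected to die).
-/

noncomputable section

namespace Summit.CriticalPhenomena.Ising3DConformalLimit.Cruxes.InfraredExponentZero.Birth

open Filter Topology Finset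
open Literature.Probability.LatticeModels

/-! ### The two stubs (the only `sorry`s of this file; signatures in pure tree vocabulary —
`sphere`, `criticalTwoPoint`, `Site.supNorm` of `Literature.Probability.LatticeModels` — so that each
lands verbatim as a `Theorems/CanonicalBranchRefutationInfraredExponentZero<Stub>.lean` helper) -/

/-- **stub 1 — THE BET (sphere-mass growth, averaged form of `η(3) ≤ 0`)**: the critical sphere masses
on `ℤ³`, `M(n) = ∑_{y ∈ ∂Λ_n} ⟨σ₀σ_y⟩⁺_{β_c}` (`∂Λ_n = {‖y‖_∞ = n}`, the tree's `sphere 3 n`), satisfy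
`M(n) ≥ n^{1-ε}` for all large `n`, for every `ε > 0`. Known rigorously: `c ≤ M(n) ≤ C n`
(Simon–Lieb at `β_c` / infrared bound); EQUIVALENT to the crux given the tree's infrared ceiling and
stub 2 (converse `InfraredExponentZero → stub 1` is elementary: `M(n) ≥ #∂Λ_n · n^{-(1+ε)}`); expected
FALSE at exponent `1` (`M(n) ~ n^{1-η}`, `η(3) ≈ 0.0363`) but open both ways in print. Refuters: kill it
with `M(n_k) ≤ n_k^{1-δ}` along a sequence. [cite: Simon1980, Thm. 1] [cite: DuminilCopinICM2022, §4.2.1]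
[cite: KosPolandSimmonsDuffinVichi2016] -/
theorem stub_sphereMass_growth :
    ∀ ε : ℝ, 0 < ε → ∀ᶠ n : ℕ in atTop,
      (n : ℝ) ^ (1 - ε) ≤ ∑ y ∈ sphere 3 n, criticalTwoPoint 3 y := by
  sorry

/-- **stub 2 — Messager–Miracle-Solé de-averaging of sphere masses**: there is `c > 0` such that for
every `x ≠ 0` in `ℤ³`, with `m = ‖x‖_∞`, `⟨σ₀σ_x⟩⁺_{β_c} ≥ c m⁻² ∑_{y ∈ ∂Λ_{3m}} ⟨σ₀σ_y⟩⁺_{β_c}`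
(`⟨σ₀σ_x⟩ ≥ ⟨σ₀σ_{3m e₁}⟩ ≥ ⟨σ₀σ_y⟩` for `‖y‖_∞ = 3m` by (Mes-Mir) used twice, and
`#∂Λ_{3m} ≤ 6(6m+1)² ≤ 294 m²`). Recipe from the tree: `twoPointPlus_diagAxis_le_of_mem_sphere`,
`twoPointPlus_le_axis_of_mem_sphere`, `card_sphere_succ_le`, fed with `messager_miracleSole_holds`,
`messager_miracleSole_diag_holds`, `twoPointPlus_reflection_invariant_holds`,
`twoPointPlus_perm_invariant_holds`; size S/M. [cite: DuminilCopin2019, §4.3 Exercise 37 (4), eq. (4.10)]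
[cite: MessagerMiracleSoleJSP1977] -/
theorem stub_sphereMass_deaveraging :
    ∃ c : ℝ, 0 < c ∧ ∀ x : Site 3, x ≠ 0 →
      c * ((Site.supNorm x : ℝ) ^ 2)⁻¹ * (∑ y ∈ sphere 3 (3 * Site.supNorm x), criticalTwoPoint 3 y)
        ≤ criticalTwoPoint 3 x :=
  -- LANDED (p145289): the Theorems-side proof, imported.
  Summit.CriticalPhenomena.Ising3DConformalLimit.Theorems.stub_sphereMass_deaveraging

/-! ### Name-keyed aliases of the two statements — the hypotheses of `InfraredExponentZero_of`
(the native skeleton audit `#h21_check_skeleton` admits a `Prop` hypothesis whose HEAD CONSTANT is named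
like a declared stub; the `__Registered` namespace is an implementation detail — same device as the
registered skeleton `Cruxes/IndependentStrandsJoin/Lines/cross_fattening_decoupling.lean`). -/
namespace __Registered

/-- Statement of `stub_sphereMass_growth`, keyed by the registered stub name. -/
abbrev stub_sphereMass_growth : Prop :=
  ∀ ε : ℝ, 0 < ε → ∀ᶠ n : ℕ in atTop,
    (n : ℝ) ^ (1 - ε) ≤ ∑ y ∈ sphere 3 n, criticalTwoPoint 3 y

/-- Statement of `stub_sphereMass_deaveraging`, keyed by the registered stub name. -/
abbrev stub_sphereMass_deaveraging : Prop :=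
  ∃ c : ℝ, 0 < c ∧ ∀ x : Site 3, x ≠ 0 →
    c * ((Site.supNorm x : ℝ) ^ 2)⁻¹ * (∑ y ∈ sphere 3 (3 * Site.supNorm x), criticalTwoPoint 3 y)
      ≤ criticalTwoPoint 3 x

end __Registered

/-! ### Proved glue: the ε-squeeze for logarithmic exponents -/

/-- **Squeeze (proved).** If `G ≤ C‖x‖⁻¹` eventually and, for every `ε > 0`,
`c_ε ‖x‖^{-(1+ε)} ≤ G` eventually along `cofinite` on `ℤ³`, then `log G(x) / log ‖x‖ → -1`, i.e.
`HasSpatialDecayExponent G 1`. (ε-version of the tree's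
`IsPowerBounded.hasSpatialDecayExponent_holds`.) [folklore] -/
theorem hasSpatialDecayExponent_one_of_envelopes {G : Site 3 → ℝ}
    (hup : ∃ C : ℝ, ∀ᶠ x : Site 3 in cofinite, G x ≤ C * ‖x‖ ^ (-(1 : ℝ)))
    (hlow : ∀ ε : ℝ, 0 < ε → ∃ c : ℝ, 0 < c ∧
      ∀ᶠ x : Site 3 in cofinite, c * ‖x‖ ^ (-(1 + ε)) ≤ G x) :
    HasSpatialDecayExponent G 1 := by
  unfold HasSpatialDecayExponent
  have hnorm := Site.tendsto_norm_cofinite_atTop (d := 3)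
  have hlog : Tendsto (fun x : Site 3 => Real.log ‖x‖) cofinite atTop :=
    Real.tendsto_log_atTop.comp hnorm
  have hev1 : ∀ᶠ x : Site 3 in cofinite, 1 < ‖x‖ := hnorm.eventually_gt_atTop 1
  have hconst : ∀ K κ : ℝ,
      Tendsto (fun x : Site 3 => Real.log K / Real.log ‖x‖ + (-κ)) cofinite (𝓝 (-κ)) := by
    intro K κ
    simpa using (hlog.const_div_atTop (Real.log K)).add_const (-κ)
  rw [tendsto_order]
  constructor
  · -- lower side: for `a < -1`, eventually `a < log G / log ‖x‖`
    intro a ha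
    set κ : ℝ := 1 + (-1 - a) / 2 with hκ
    have hεpos : 0 < (-1 - a) / 2 := by linarith
    have hgt : a < -κ := by rw [hκ]; linarith
    obtain ⟨c, hc, hlowc⟩ := hlow ((-1 - a) / 2) hεpos
    filter_upwards [(hconst c κ).eventually_const_lt hgt, hlowc, hev1] with x hx hGx hx1
    have hxpos : 0 < ‖x‖ := by linarith
    have hlogx : 0 < Real.log ‖x‖ := Real.log_pos hx1
    have hpow : 0 < ‖x‖ ^ (-κ) := Real.rpow_pos_of_pos hxpos _
    have hGx' : c * ‖x‖ ^ (-κ) ≤ G x := by rw [hκ]; exact hGx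
    have hGpos : 0 < G x := (mul_pos hc hpow).trans_le hGx'
    have hle : Real.log c + (-κ) * Real.log ‖x‖ ≤ Real.log (G x) := by
      rw [← Real.log_rpow hxpos, ← Real.log_mul hc.ne' hpow.ne']
      exact Real.log_le_log (mul_pos hc hpow) hGx'
    refine hx.trans_le ?_
    rw [div_add' _ _ _ hlogx.ne', div_le_div_iff_of_pos_right hlogx]
    linarith
  · -- upper side: for `b > -1`, eventually `log G / log ‖x‖ < b`
    intro b hb
    obtain ⟨C, hupC⟩ := hup
    obtain ⟨c, hc, hlowc⟩ := hlow 1 one_pos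
    have hCpos : 0 < max C 1 := lt_max_of_lt_right one_pos
    filter_upwards [(hconst (max C 1) 1).eventually_lt_const hb, hupC, hlowc, hev1] with
      x hx hGx hGlow hx1
    have hxpos : 0 < ‖x‖ := by linarith
    have hlogx : 0 < Real.log ‖x‖ := Real.log_pos hx1
    have hpow1 : 0 < ‖x‖ ^ (-(1 : ℝ)) := Real.rpow_pos_of_pos hxpos _
    have hpow2 : 0 < ‖x‖ ^ (-(1 + 1 : ℝ)) := Real.rpow_pos_of_pos hxpos _
    have hGpos : 0 < G x := (mul_pos hc hpow2).trans_le hGlow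
    have hGx' : G x ≤ max C 1 * ‖x‖ ^ (-(1 : ℝ)) :=
      hGx.trans (mul_le_mul_of_nonneg_right (le_max_left _ _) hpow1.le)
    have hle : Real.log (G x) ≤ Real.log (max C 1) + (-(1 : ℝ)) * Real.log ‖x‖ := by
      rw [← Real.log_rpow hxpos, ← Real.log_mul hCpos.ne' hpow1.ne']
      exact Real.log_le_log hGpos hGx'
    refine lt_of_le_of_lt ?_ hx
    rw [div_add' _ _ _ hlogx.ne', div_le_div_iff_of_pos_right hlogx]
    linarith

/-! ### The composition: stubs ⇒ crux (by name) -/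

/-- **Assembly (kernel-checked, no sorry).** The two stubs imply the crux (the second, de-averaging, is
LANDED as p145289 and discharged inside the proof; the only hypothesis left is `stub_sphereMass_growth`)
`CanonicalBranchRefutation.InfraredExponentZero = HasIsingExponentEta 3 0`: sphere-mass growth
de-averaged by Messager–Miracle-Solé gives the lower envelope `c_ε‖x‖^{-(1+ε)} ≤ ⟨σ₀σ_x⟩_{β_c}`,
the tree's infrared ceiling (`criticalTwoPoint_bounds_holds`) gives `⟨σ₀σ_x⟩_{β_c} ≤ C‖x‖⁻¹`, and
the squeeze gives `log⟨σ₀σ_x⟩/log‖x‖ → -1 = -(3-2+0)`. [cite: DuminilCopin2019, Thm. 4.8]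
[cite: FriedliVelenik2017, §3.10.11] -/
theorem InfraredExponentZero_of
    (h_growth : __Registered.stub_sphereMass_growth) :
    Summit.CriticalPhenomena.Ising3DConformalLimit.Theses.CanonicalBranchRefutation.InfraredExponentZero := by
  unfold __Registered.stub_sphereMass_growth at h_growth
  -- the second stub is LANDED (p145289): discharged here, no longer a hypothesis
  have h_deav : __Registered.stub_sphereMass_deaveraging := stub_sphereMass_deaveraging
  unfold __Registered.stub_sphereMass_deaveraging at h_deav
  -- Step 1: the lower envelope `c ‖x‖^{-(1+ε)} ≤ G x`, eventually, for every `ε > 0`.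
  have hlowenv : ∀ ε : ℝ, 0 < ε → ∃ c : ℝ, 0 < c ∧
      ∀ᶠ x : Site 3 in cofinite, c * ‖x‖ ^ (-(1 + ε)) ≤ criticalTwoPoint 3 x := by
    intro ε hε
    obtain ⟨c, hc, hdeav⟩ := h_deav
    obtain ⟨N, hN⟩ := eventually_atTop.1 (h_growth ε hε)
    refine ⟨c * (3 : ℝ) ^ (1 - ε), by positivity, ?_⟩
    -- eventually (cofinite) `‖x‖_∞ ≥ max N 1`: the exceptional set lies in the finite box `Λ_{max N 1}`
    have hev : ∀ᶠ x : Site 3 in cofinite, max N 1 ≤ Site.supNorm x := by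
      rw [eventually_cofinite]
      refine (box 3 (max N 1)).finite_toSet.subset fun x hx => ?_
      rw [Set.mem_setOf_eq, not_le] at hx
      rw [Finset.mem_coe, mem_box_iff_supNorm_le]
      exact hx.le
    filter_upwards [hev] with x hx
    have hxN : N ≤ Site.supNorm x := le_of_max_le_left hx
    have hx1 : 1 ≤ Site.supNorm x := le_of_max_le_right hx
    have hx0 : x ≠ 0 := by
      intro h0
      rw [← Site.supNorm_eq_zero_iff] at h0
      omega
    have hmpos : (0 : ℝ) < (Site.supNorm x : ℝ) := by exact_mod_cast hx1
    have h3m : N ≤ 3 * Site.supNorm x := by omega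
    have hmass : ((3 * Site.supNorm x : ℕ) : ℝ) ^ (1 - ε) ≤
        ∑ y ∈ sphere 3 (3 * Site.supNorm x), criticalTwoPoint 3 y := hN _ h3m
    have hdx := hdeav x hx0
    have hnorm : ‖x‖ = (Site.supNorm x : ℝ) := Site.norm_eq_supNorm x
    rw [hnorm]
    have hsplit : (Site.supNorm x : ℝ) ^ (-(1 + ε)) =
        ((Site.supNorm x : ℝ) ^ 2)⁻¹ * (Site.supNorm x : ℝ) ^ (1 - ε) := by
      rw [show (-(1 + ε) : ℝ) = (1 - ε) + -2 by ring, Real.rpow_add hmpos,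
        Real.rpow_neg hmpos.le, Real.rpow_two]
      ring
    calc c * (3 : ℝ) ^ (1 - ε) * (Site.supNorm x : ℝ) ^ (-(1 + ε))
        = c * ((Site.supNorm x : ℝ) ^ 2)⁻¹ *
            ((3 : ℝ) ^ (1 - ε) * (Site.supNorm x : ℝ) ^ (1 - ε)) := by
          rw [hsplit]; ring
      _ ≤ c * ((Site.supNorm x : ℝ) ^ 2)⁻¹ *
            (∑ y ∈ sphere 3 (3 * Site.supNorm x), criticalTwoPoint 3 y) := by
          apply mul_le_mul_of_nonneg_left _ (by positivity)
          calc (3 : ℝ) ^ (1 - ε) * (Site.supNorm x : ℝ) ^ (1 - ε)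
              = ((3 * Site.supNorm x : ℕ) : ℝ) ^ (1 - ε) := by
                rw [Nat.cast_mul, Nat.cast_ofNat, Real.mul_rpow (by norm_num) hmpos.le]
            _ ≤ _ := hmass
      _ ≤ criticalTwoPoint 3 x := hdx
  -- Step 2: the infrared ceiling from the tree (Duminil-Copin 2019 Thm. 4.8, `d = 3`).
  obtain ⟨c₀, C₀, hc₀, hbounds⟩ := criticalTwoPoint_bounds_holds (d := 3) le_rfl
  have hup : ∃ C : ℝ, ∀ᶠ x : Site 3 in cofinite, criticalTwoPoint 3 x ≤ C * ‖x‖ ^ (-(1 : ℝ)) := by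
    refine ⟨C₀, ?_⟩
    filter_upwards [eventually_cofinite_ne (0 : Site 3)] with x hx
    have hb := (hbounds x hx).2
    have hexp : (-(((3 : ℕ) : ℝ) - 2)) = (-(1 : ℝ)) := by norm_num
    rwa [hexp] at hb
  -- Step 3: squeeze, and `3 - 2 + 0 = 1`.
  have key : HasSpatialDecayExponent (criticalTwoPoint 3) 1 :=
    hasSpatialDecayExponent_one_of_envelopes hup hlowenv
  show HasIsingExponentEta 3 0
  unfold HasIsingExponentEta
  have h1 : ((3 : ℕ) : ℝ) - 2 + 0 = 1 := by norm_num
  rw [h1]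
  exact key

/-- Shape check: the stub statements are literally the hypotheses of `InfraredExponentZero_of`. -/
example :
    Summit.CriticalPhenomena.Ising3DConformalLimit.Theses.CanonicalBranchRefutation.InfraredExponentZero :=
  InfraredExponentZero_of stub_sphereMass_growth

end Summit.CriticalPhenomena.Ising3DConformalLimit.Cruxes.InfraredExponentZero.Birth
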